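import Mathlib
import HarnessLib
import Summits.CriticalPhenomena.CardyFormulaZ2.Theses.CardyComplexCone
import Literature.Probability.Percolation.AnnulusCrossingBound
import Literature.Probability.Percolation.CardyFormula
import Literature.Probability.RandomPlanarGeometry.CritPercSLE

/-!
# Sketch — crux-ideate for `SLESixFamiliesGiveCardy` (stmt-CriticalPhenomena-9654), ideator 1, round 1

First lemmas of the two idea cards (they need not be proved here; they must elaborate):

* `CollarBridge`      — card `conformal-collar-ss-bridge` (inner conformal collar + Schramm–Smirnov 6.1);
* `OvershootInclusion`— card `overshoot-lune-sandwich` (exterior-lune overshoot, Bollobás–Riordan order);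
* `ProximityLiminf`   — the shared SLE-side half of the one-sided proximity dictionary (both cards).
-/

namespace Summit.CriticalPhenomena.CardyFormulaZ2.Cruxes.SLESixFamiliesGiveCardy.Sketch

open scoped Topology
open Filter Set MeasureTheory
open UpperHalfPlane (upperHalfPlaneSet)
open Literature.Probability.Percolation Literature.Probability.LatticeModels
open Literature.Probability.RandomPlanarGeometry

/-- **Card 1, first lemma (CollarBridge).** An open path of `Ω_δ` from the *conformal*
`s`-collar of the arc `(ab)` (the `φ`-image of the `s`-neighbourhood in `ℍ` of the boundary
interval `[x₀, x₁]`) into the conformal `s`-collar of `(cd)` (`[x₂, x₃]`) is, up to probability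
`ε`, a genuine free crossing of the conformal rectangle: Schramm–Smirnov 2011 Lemma 6.1
(cases (2)+(3), tree fact `SchrammSmirnov2011_lemma_6_1`) with the `δ₁`-short joins
`φ(w) ↦ φ(Re w)` (Carathéodory uniform continuity of `φ` near `[x₀ - 1, x₃ + 1]`), plus corner
one-arm events (`annulusOpenCrossing_half_le_holds`). This is what turns the escort chain of the
exploration (which starts at a WIRED arc site, possibly a concave lattice corner, and ends `1/m`
short of `(cd)`) into `discreteCrossing`. -/
def CollarBridge : Prop :=
  ∀ (R : ConformalRectangle) (φ : ConformalEquiv upperHalfPlaneSet R.carrier) (x : Fin 4 → ℝ),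
    R.IsUniformizing φ x → ∀ ε > (0:ℝ), ∃ s > (0:ℝ), ∀ᶠ δ in 𝓝[>] (0:ℝ),
      (bondPercolation (zdGraph 2) half).real
          {ω | ∃ u v : Site 2,
            meshPoint δ u ∈ (φ : ℂ → ℂ) ''
              {w : ℂ | 0 < w.im ∧
                Metric.infDist w ((fun t : ℝ => (t : ℂ)) '' Set.uIcc (x 0) (x 1)) < s} ∧
            meshPoint δ v ∈ (φ : ℂ → ℂ) ''
              {w : ℂ | 0 < w.im ∧
                Metric.infDist w ((fun t : ℝ => (t : ℂ)) '' Set.uIcc (x 2) (x 3)) < s} ∧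
            (openGraph ω ⊓ discreteDomainGraph R.carrier δ).Reachable u v}
        ≤ bondDomainCrossingProb R δ + ε

/-- **Card 2, first lemma (OvershootInclusion)** — the `ℤ²`-bond, construction-free form of
Bollobás–Riordan 2006, Ch. 7, Claim 19 (lower half) + Claim 20 (tree, `𝕋` version:
`TriMarkedDomain.openCrossing_subset_triCrossing_union`): an `ω`-open lattice chain that starts
OUTSIDE `Ω̄` near `(ab)`, ends OUTSIDE `Ω̄` near `(cd)`, whose far-from-corner sites are
`t₀`-close to `(ab) ∪ (cd)` when outside `Ω` and farther than `δ` from `(bc) ∪ (da)` when inside,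
contains a G02 crossing `discreteCrossing Ω δ (ab) (cd)` of the largest-component discretisation,
unless it produces an open one-arm event around a marked point. -/
def OvershootInclusion : Prop :=
  ∀ R : ConformalRectangle, ∃ r₂ > (0:ℝ), ∀ ρ : ℝ, 0 < ρ → ρ ≤ r₂ → ∃ t₀ > (0:ℝ), ∃ δ₀ > (0:ℝ),
    ∀ δ : ℝ, 0 < δ → δ < δ₀ → ∀ (ω : BondConfig (Site 2)) (N : ℕ) (v : ℕ → Site 2),
      (∀ i < N, (zdGraph 2).Adj (v i) (v (i + 1)) ∧ s(v i, v (i + 1)) ∈ ω) →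
      meshPoint δ (v 0) ∉ closure R.carrier →
      Metric.infDist (meshPoint δ (v 0)) (R.arc 0) ≤ t₀ →
      meshPoint δ (v N) ∉ closure R.carrier →
      Metric.infDist (meshPoint δ (v N)) (R.arc 2) ≤ t₀ →
      (∀ i ≤ N, (∀ j : Fin 4, ρ ≤ dist (meshPoint δ (v i)) (R.pt j)) →
        meshPoint δ (v i) ∉ R.carrier →
          Metric.infDist (meshPoint δ (v i)) (R.arc 0 ∪ R.arc 2) ≤ t₀) →
      (∀ i ≤ N, (∀ j : Fin 4, ρ ≤ dist (meshPoint δ (v i)) (R.pt j)) →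
        meshPoint δ (v i) ∈ R.carrier →
          δ < Metric.infDist (meshPoint δ (v i)) (R.arc 1 ∪ R.arc 3)) →
      ω ∈ discreteCrossing R.carrier δ (R.arc 0) (R.arc 2) ∨
        ∃ j : Fin 4, ω ∈ annulusOpenCrossing (R.pt j) δ ρ r₂

/-- **Shared SLE-side lemma (ProximityLiminf).** Whatever the interfaces `X δ` are, convergence in
law to chordal SLE₆ in `(Ω; a, c)` gives, for the OPEN proximity events
`U₂(a,b) = mk '' hitsBeforeApprox (cd) (bc) a b`, the one-sided bound
`P[X δ ∈ U₂(a,b)] ≥ F(η) - θ` eventually, for some `b = b(θ) > 0` and every `a > 0`: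
portmanteau (liminf over an open set, `convergesInLawToSLE_iff_tendstoInDistribution`), the
`G_δσ` exhaustion `hitsBefore_eq_iUnion_iInter` and the SLE₆ hitting law
`sle_six_measureReal_hitsBefore` (discharged in the tree). No boundary estimate enters. -/
def ProximityLiminf : Prop :=
  ∀ (R : ConformalRectangle) (X : ℝ → BondConfig (Site 2) → CurveClass ℂ),
    ConvergesInLawToSLE 6 (R.chord 0 2 (by decide)) (Ωδ := fun _ => BondConfig (Site 2)) X
        (fun _ => bondPercolation (zdGraph 2) half) →
    ∀ (φ : ConformalEquiv upperHalfPlaneSet R.carrier) (x : Fin 4 → ℝ), R.IsUniformizing φ x →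
      ∀ θ > (0:ℝ), ∃ b > (0:ℝ), ∀ a > (0:ℝ), ∀ᶠ δ in 𝓝[>] (0:ℝ),
        cardyFunction (crossRatio x) - θ ≤
          (bondPercolation (zdGraph 2) half).real
            ((X δ) ⁻¹' (CurveClass.mk '' CurveClass.hitsBeforeApprox (R.arc 2) (R.arc 1) a b))

end Summit.CriticalPhenomena.CardyFormulaZ2.Cruxes.SLESixFamiliesGiveCardy.Sketch
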